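import Literature.Analysis.FluidPDE.TaoCascadeReducedClaimLinks
import Literature.Analysis.FluidPDE.TaoCascadeReducedClaimExit
import Literature.Analysis.FluidPDE.TaoCascadeSecondBootstrap
import Mathlib.Analysis.SpecialFunctions.Pow.Asymptotics
import HarnessLib

/-!
# Tao's cascade ODE, §6.5–6.7: the assembly of Prop. 6.12 (hence Prop. 6.5) from Props. 6.13 and 6.15

T. Tao, *Finite time blowup for an averaged three-dimensional Navier–Stokes equation*,
J. Amer. Math. Soc. 29 (2016), 601–674 = arXiv:1402.0290v3, §6.6: "The task of proving
Proposition 6.12 has now reduced further, to that of establishing [Prop. 6.15] … Indeed,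
Proposition 6.12 follows from Proposition 6.15 and Proposition 6.13 once we set `μ₁ := a₁(τ₁)`
(and take `K` sufficiently large, `ε` sufficiently small, and `n₀` sufficiently large)."

This file performs that assembly once and for all, with the two analytic inputs of §6.6–6.7 as
hypotheses in packaging-neutral `InRegime` form (`TaoCascadeRescaledRegime.lean`), so that the
corrected Prop. 6.5 (`rescaledStepCorrected'`, the statement consumed by
`noGlobalODESolution_of_rescaledStepCorrected'`) follows from exactly two regime statements:

* `SmallScaleOneInput` — **Prop. 6.13 in the regime**, implied constants absorbed: for every
  `T ∈ [0, 100]` with the bootstrap bounds (6.92)–(6.95) (`GoodAt`) on `[0, T]` and (6.115)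
  `∫₀ᵀ a₁² ≤ K^{-1/4}`, on `[0, T]`: `|b₁| ≤ 11 K^{-1/4} ε` ((6.116); the constant `11` is the one of
  the sibling's `RescaledHypotheses.prop613_regime`), `|c₁| ≤ K^{-1/4} e^{-K¹⁰/2} ε²` ((6.117)),
  `c₁ ≥ -½(1+ε₀)^{-n₀/4}` ((6.118) `-O((1+ε₀)^{-n₀/3})` weakened to the exponent `n₀/4`, which is
  all (6.109) needs), `|d₁| < ½K⁻¹⁰` ((6.119), the forwards-exit exclusion; the printed `K⁻²⁰` is
  not needed);
* `ReducedClaimIIInput` — **Prop. 6.15 in the regime**: for every `T ∈ [0, 100]` with `GoodAt` and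
  the above bounds on `[0, T]`, `∫₀ᵗ a₁² ≤ K^{-1/4}` on `[0, T]` and Cor. 6.14 at `T`
  (`ZeroScale.ExitTrichotomy`), there is `τ₁ ∈ [1/100, T]` with the state bounds (6.139)–(6.144)
  (`ZeroScale.NextState`).

Both are meant to be discharged from the pointwise theorems of the sibling files
(`RescaledHypotheses.prop613_regime` / `prop613_smallModes` / `prop613_d_one_lt`,
`TaoCascadeScaleOneRegime.lean`; the `ZeroScale.Context`-based
proof of Prop. 6.15, `TaoCascadeZeroScale*.lean`, via `RescaledHypotheses.zeroScale_context`) with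
`InRegime.of_K / of_eps / of_n0`. Proved here: `reducedClaimCorrected_of_inputs` (Prop. 6.12: the
bootstrap time `T₁` ↦ Cor. 6.14 at `T₂` by `exists_second_bootstrap_time` ↦ Prop. 6.15 at `T₂` ↦
`μ₁ := a₁(τ₁)` by `ReducedConclusion.of_nextState`, with `K` large for
`11 K^{-1/4} ≤ 1/(2·10⁵)`) and `rescaledStepCorrected'_of_inputs`.

## References

* T. Tao, J. Amer. Math. Soc. 29 (2016), 601–674 = arXiv:1402.0290v3, §6.5 Prop. 6.12, §6.6 Props.
  6.13, 6.15, Cor. 6.14 and the two reduction sentences quoted above. [`Tao2016AveragedNS`]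
-/

noncomputable section

open Set MeasureTheory intervalIntegral Filter
open scoped _root_.Topology

namespace Literature.Analysis.FluidPDE

namespace TaoCascade

open Literature.Analysis.ODE

/-! ## The two inputs -/

/-- **Prop. 6.13 in the regime of Prop. 6.5 (corrected coefficient), implied constants absorbed**:
see the module docstring. A regime statement (`InRegime`), to be discharged from
`RescaledHypotheses.prop613_regime` (`TaoCascadeScaleOneRegime.lean`).
[cite: Tao2016AveragedNS, §6.6 Prop. 6.13 (6.115)–(6.119)] -/
def SmallScaleOneInput : Prop :=
  InRegime (fun K => 1 / 10 ^ 5 * Real.exp (-K ^ 10 / 2)) fun D =>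
    ∀ T ∈ Icc (0 : ℝ) 100, (∀ t ∈ Icc 0 T, GoodAt D.ε₀ D.K D.Y D.F t) →
      (∫ t in (0 : ℝ)..T, D.Y 0 1 t ^ 2) ≤ D.K ^ (-(1 : ℝ) / 4) →
        ∀ t ∈ Icc 0 T,
          |D.Y 1 1 t| ≤ 11 * D.K ^ (-(1 : ℝ) / 4) * D.ε ∧
          |D.Y 2 1 t| ≤ D.K ^ (-(1 : ℝ) / 4) * Real.exp (-D.K ^ 10 / 2) * D.ε ^ 2 ∧
          -(1 / 2 * (1 + D.ε₀) ^ (-(D.n₀ : ℝ) / 4)) ≤ D.Y 2 1 t ∧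
          |D.Y 3 1 t| < 1 / 2 * (D.K ^ 10)⁻¹

/-- **Prop. 6.15 in the regime of Prop. 6.5 (corrected coefficient)**, for an arbitrary time `T`
carrying the properties of `T₂`: see the module docstring. A regime statement (`InRegime`), to be
discharged from the `ZeroScale.Context`-based proof of §6.7.
[cite: Tao2016AveragedNS, §6.6 Prop. 6.15 (6.138)–(6.144); §6.7] -/
def ReducedClaimIIInput : Prop :=
  InRegime (fun K => 1 / 10 ^ 5 * Real.exp (-K ^ 10 / 2)) fun D =>
    ∀ T ∈ Icc (0 : ℝ) 100, (∀ t ∈ Icc 0 T, GoodAt D.ε₀ D.K D.Y D.F t) →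
      (∀ t ∈ Icc 0 T,
          |D.Y 1 1 t| ≤ 11 * D.K ^ (-(1 : ℝ) / 4) * D.ε ∧
          |D.Y 2 1 t| ≤ D.K ^ (-(1 : ℝ) / 4) * Real.exp (-D.K ^ 10 / 2) * D.ε ^ 2 ∧
          -(1 / 2 * (1 + D.ε₀) ^ (-(D.n₀ : ℝ) / 4)) ≤ D.Y 2 1 t ∧
          |D.Y 3 1 t| < 1 / 2 * (D.K ^ 10)⁻¹) →
        (∀ t ∈ Icc 0 T, (∫ s in (0 : ℝ)..t, D.Y 0 1 s ^ 2) ≤ D.K ^ (-(1 : ℝ) / 4)) →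
          ZeroScale.ExitTrichotomy D.ε₀ D.K D.Y D.F T →
            ∃ τ₁ ∈ Icc (1 / 100 : ℝ) T, ZeroScale.NextState D.ε₀ D.K D.ε D.Y D.F τ₁

/-! ## The assembly -/

/-- `11 K^{-1/4} ≤ 1/(2·10⁵)` for `K` large. [folklore] -/
theorem eventually_eleven_mul_rpow_neg_quarter_le :
    ∀ᶠ K : ℝ in atTop, 11 * K ^ (-(1 : ℝ) / 4) ≤ 1 / (2 * 10 ^ 5) := by
  have h : Tendsto (fun K : ℝ => K ^ (-((1 : ℝ) / 4))) atTop (𝓝 0) :=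
    tendsto_rpow_neg_atTop (by norm_num)
  have h' : Tendsto (fun K : ℝ => 11 * K ^ (-(1 : ℝ) / 4)) atTop (𝓝 (11 * 0)) :=
    (h.congr fun K => by norm_num).const_mul 11
  rw [mul_zero] at h'
  exact h'.eventually_le_const (by norm_num)

/-- **Prop. 6.12 (corrected) from Prop. 6.13 and Prop. 6.15 in the regime.** For a datum in the
regime and a bootstrap time `T₁`: Cor. 6.14 holds at the second bootstrap time `T₂ ≤ T₁`
(`exists_second_bootstrap_time`, the forwards exit being excluded by Prop. 6.13's `|d₁| < ½K⁻¹⁰`),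
Prop. 6.15 gives `τ₁ ∈ [1/100, T₂]` with (6.139)–(6.144), and `μ₁ := a₁(τ₁)` with Prop. 6.13's
bounds at `τ₁` gives (6.104)–(6.114) (`ReducedConclusion.of_nextState`; `K` large).
[cite: Tao2016AveragedNS, §6.6, the sentence after Prop. 6.15] -/
theorem reducedClaimCorrected_of_inputs (h13 : SmallScaleOneInput) (h15 : ReducedClaimIIInput) :
    reducedClaimCorrected := by
  have hK : InRegime (fun K => 1 / 10 ^ 5 * Real.exp (-K ^ 10 / 2)) fun D =>
      11 * D.K ^ (-(1 : ℝ) / 4) ≤ 1 / (2 * 10 ^ 5) :=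
    InRegime.of_K (p := fun _ _ K => 11 * K ^ (-(1 : ℝ) / 4) ≤ 1 / (2 * 10 ^ 5)) fun _ _ _ _ _ =>
      eventually_eleven_mul_rpow_neg_quarter_le
  unfold reducedClaimCorrected reducedClaimWith
  refine ((h13.and h15).and hK).mono ?_
  rintro D hD ⟨⟨h13D, h15D⟩, hKD⟩ T₁ hT₁
  have hT₁mem : T₁ ∈ Icc (0 : ℝ) 100 := ⟨hT₁.pos.le, hT₁.le_hundred⟩
  -- Cor. 6.11 at `T₁` in the shape with exponent `2/10`
  have hexit : D.F (-1) T₁ = (D.K ^ 10)⁻¹ * (1 + D.ε₀) ^ ((2 : ℝ) / 10) ∨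
      |D.Y 3 1 T₁| = 1 / 2 * (D.K ^ 10)⁻¹ ∨ T₁ = 100 := by
    have e : ((2 : ℝ) / 10) = (1 : ℝ) / 5 := by norm_num
    rw [e]; exact hT₁.exit
  -- the forwards-exit exclusion from Prop. 6.13
  have h13d : ∀ T ∈ Icc 0 T₁, (∫ t in (0 : ℝ)..T, D.Y 0 1 t ^ 2) ≤ D.K ^ (-(1 : ℝ) / 4) →
      |D.Y 3 1 T| < 1 / 2 * (D.K ^ 10)⁻¹ := fun T hT hint =>
    (h13D T ⟨hT.1, hT.2.trans hT₁.le_hundred⟩ (fun t ht => hT₁.good t ⟨ht.1, ht.2.trans hT.2⟩) hint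
      T ⟨hT.1, le_rfl⟩).2.2.2
  -- Cor. 6.14
  obtain ⟨T₂, hT₂, hint, hex⟩ :=
    hD.hyp.exists_second_bootstrap_time hD.n₀_le_N hD.K_pos hT₁mem hexit h13d
  have hT₂mem : T₂ ∈ Icc (0 : ℝ) 100 := ⟨hT₂.1, hT₂.2.trans hT₁.le_hundred⟩
  have hgood : ∀ t ∈ Icc 0 T₂, GoodAt D.ε₀ D.K D.Y D.F t := fun t ht =>
    hT₁.good t ⟨ht.1, ht.2.trans hT₂.2⟩
  -- Prop. 6.13 on `[0, T₂]`
  have hb13 := h13D T₂ hT₂mem hgood (hint T₂ ⟨hT₂.1, le_rfl⟩)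
  -- Prop. 6.15 at `T₂`
  obtain ⟨τ₁, hτ₁, hns⟩ := h15D T₂ hT₂mem hgood hb13 hint hex
  -- `μ₁ := a₁(τ₁)`
  have hτ₁' : τ₁ ∈ Icc 0 T₂ := ⟨by linarith [hτ₁.1], hτ₁.2⟩
  obtain ⟨hb, hc, hcge, -⟩ := hb13 τ₁ hτ₁'
  refine ⟨τ₁, D.Y 0 1 τ₁, ReducedConclusion.of_nextState hD.ε₀_pos hD.ε₀_lt_one hD.K_pos hD.ε_pos
    hT₂.2 hτ₁ hns hb hc hcge ?_ ?_ le_rfl⟩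
  · -- `10 K^{-1/4} ε ≤ ε/(2·10⁵)`
    calc 11 * D.K ^ (-(1 : ℝ) / 4) * D.ε ≤ 1 / (2 * 10 ^ 5) * D.ε :=
          mul_le_mul_of_nonneg_right hKD hD.ε_pos.le
      _ = D.ε / (2 * 10 ^ 5) := by ring
  · -- `K^{-1/4} e^{-K¹⁰/2} ε² ≤ (10⁻⁵ e^{-K¹⁰/2}) ε²/2`
    have h1 : D.K ^ (-(1 : ℝ) / 4) ≤ 1 / (2 * 10 ^ 5) := by
      have : 0 ≤ D.K ^ (-(1 : ℝ) / 4) := (Real.rpow_pos_of_pos hD.K_pos _).le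
      linarith
    have h2 : 0 ≤ Real.exp (-D.K ^ 10 / 2) * D.ε ^ 2 := by positivity
    calc D.K ^ (-(1 : ℝ) / 4) * Real.exp (-D.K ^ 10 / 2) * D.ε ^ 2
        = D.K ^ (-(1 : ℝ) / 4) * (Real.exp (-D.K ^ 10 / 2) * D.ε ^ 2) := by ring
      _ ≤ 1 / (2 * 10 ^ 5) * (Real.exp (-D.K ^ 10 / 2) * D.ε ^ 2) :=
          mul_le_mul_of_nonneg_right h1 h2
      _ = 1 / 10 ^ 5 * Real.exp (-D.K ^ 10 / 2) * D.ε ^ 2 / 2 := by ring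

/-- **The corrected Prop. 6.5 (`rescaledStepCorrected'`) from Prop. 6.13 and Prop. 6.15 in the
regime** — the whole reduction Prop. 6.5 ⇐ 6.12 ⇐ 6.13 ∧ 6.15 of §6.5–6.6, with Lemmas 6.7–6.10,
Cor. 6.11 (sibling files) and Cor. 6.14 proved. [cite: Tao2016AveragedNS, §6.5–6.6] -/
theorem rescaledStepCorrected'_of_inputs (h13 : SmallScaleOneInput) (h15 : ReducedClaimIIInput) :
    rescaledStepCorrected' :=
  rescaledStepCorrected'_of_reducedClaimCorrected (reducedClaimCorrected_of_inputs h13 h15)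

end TaoCascade

end Literature.Analysis.FluidPDE
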